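import Summits.PneNP.PneNP.Theorems.PhaseTwinsConstantFactorTwinsEverywhereSign
import Literature.ModelTheory.FiniteModelTheory.CountingWidthParameterProofs

/-!
# Route PhaseTwins, support `ConstantFactorTwinsEverywhere` (stmt-PneNP-2726): `Z(CFI_even) ≠ Z(CFI_odd)`

* PARITY DICHOTOMY (`cfiGraph_iso_dichotomy`; Cai–Fürer–Immerman 1992, Lemma 6.2, in the form needed
  here): over a CONNECTED base graph every `CFI(G, T)` is isomorphic to `CFI(G, ∅)` or to `CFI(G, {e₀})`
  for a fixed edge `e₀` — twists are moved along walks and cancelled in pairs with the tree's gauge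
  isomorphisms (`exists_gauge`, `gaugeIso` of `CountingWidthParameterProofs`).
* The partition function is an isomorphism invariant (`independencePolynomial_eq_of_iso`).
* CONCLUSION (`independencePolynomial_cfi_ne`): `Z(CFI(G, ∅), λ) ≠ Z(CFI(G, {e₀}), λ)` for every
  connected `G`, edge `e₀` and `λ > 0` — otherwise all `Z(CFI(G, T_τ), λ)` are equal and the signed
  average `Σ_τ sgn(τ) Z(CFI(G, T_τ), λ) = Z · Π_d (1 - 1) = 0`, contradicting `signedSum_ne_zero`.
  (For cubic `G` the difference is in fact `±2^{β₁(G)} λ^{4|G|}`; only non-vanishing is proved.)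
-/

namespace Summit.PneNP.PneNP.PhaseTwins.ConstantFactorTwins

-- `Summit.PneNP.PneNP.…` (summit = sub-problem name) trips the duplicate-namespace linter on every declaration.
set_option linter.dupNamespace false

open Finset
open Literature.ModelTheory.FiniteModelTheory
open Literature.Probability.LatticeModels (independencePolynomial)

noncomputable section

open scoped Classical

variable {v : ℕ} {G : SimpleGraph (Fin v)} [DecidableRel G.Adj]

/-! ### Every CFI graph over a connected base is the even or the once-twisted one -/

omit [DecidableRel G.Adj] in
/-- Boolean bookkeeping for moving one twist (cf. the private `twist_aux` lemmas of the tree). -/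
theorem gauge_move_aux {a b : Bool} {A B : Prop} [Decidable A] [Decidable B]
    (h : (a ^^ b) = (decide A ^^ decide B)) (hAB : ¬ (A ∧ B)) : B ↔ (A ↔ a = b) := by
  cases a <;> cases b <;> by_cases hA : A <;> by_cases hB : B <;> simp_all

omit [DecidableRel G.Adj] in
/-- Boolean bookkeeping for cancelling two twists. -/
theorem gauge_cancel_aux {a b : Bool} {A B P : Prop} [Decidable A] [Decidable B]
    (h : (a ^^ b) = (decide A ^^ decide B)) (hAB : ¬ (A ∧ B)) (hA : A → P) (hB : B → P) :
    (P ∧ ¬ A ∧ ¬ B) ↔ (P ↔ a = b) := by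
  cases a <;> cases b <;> by_cases hA' : A <;> by_cases hB' : B <;> simp_all

/-- **Parity dichotomy** (Cai–Fürer–Immerman, Lemma 6.2, in the form needed here): over a connected
base graph every CFI graph is isomorphic to the untwisted one or to the one twisted at the fixed
edge `x₀ y₀` — by moving twists along walks and cancelling them in pairs with gauge isomorphisms. -/
theorem cfiGraph_iso_dichotomy (hconn : G.Connected) {x₀ y₀ : Fin v} (h₀ : G.Adj x₀ y₀)
    (T₁ : Set (Sym2 (Fin v))) [DecidablePred (· ∈ T₁)]
    (hT₁ : ∀ u w, G.Adj u w → (s(u, w) ∈ T₁ ↔ s(u, w) = s(x₀, y₀))) :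
    ∀ (n : ℕ) (T : Set (Sym2 (Fin v))) [DecidablePred (· ∈ T)],
      (G.edgeFinset.filter (· ∈ T)).card = n →
      Nonempty (cfiGraph G T ≃g cfiEven G) ∨ Nonempty (cfiGraph G T ≃g cfiGraph G T₁) := by
  intro n
  induction n using Nat.strong_induction_on with
  | _ n ih =>
  intro T _ hn
  set F := G.edgeFinset.filter (· ∈ T) with hF
  have hmemF : ∀ u w, G.Adj u w → (s(u, w) ∈ F ↔ s(u, w) ∈ T) := fun u w huw => by
    rw [hF, Finset.mem_filter, SimpleGraph.mem_edgeFinset, SimpleGraph.mem_edgeSet]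
    exact ⟨fun h => h.2, fun h => ⟨huw, h⟩⟩
  have hFadj : ∀ e ∈ F, ∃ x a, G.Adj x a ∧ e = s(x, a) := by
    intro e he
    have he' : e ∈ G.edgeSet := SimpleGraph.mem_edgeFinset.1 (Finset.mem_filter.1 he).1
    induction e using Sym2.ind with
    | _ x a => exact ⟨x, a, he', rfl⟩
  by_cases hempty : F = ∅
  · -- no twisted edge: the graph IS the even one
    left
    have hE : cfiGraph G T = cfiEven G := cfiGraph_congr G fun u w huw => by
      rw [← hmemF u w huw, hempty]
      simp
    rw [hE]
    exact ⟨SimpleGraph.Iso.refl⟩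
  obtain ⟨e₁, he₁⟩ := Finset.nonempty_iff_ne_empty.2 hempty
  obtain ⟨x, a, hxa, rfl⟩ := hFadj e₁ he₁
  by_cases hone : ∀ e ∈ F, e = s(x, a)
  · -- exactly one twisted edge: move it to `x₀ y₀`
    right
    have hT : ∀ u w, G.Adj u w → (s(u, w) ∈ T ↔ s(u, w) = s(x, a)) := fun u w huw => by
      rw [← hmemF u w huw]
      exact ⟨fun h => hone _ h, fun h => h ▸ he₁⟩
    by_cases hsame : s(x, a) = s(x₀, y₀)
    · have hE : cfiGraph G T = cfiGraph G T₁ := cfiGraph_congr G fun u w huw => by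
        rw [hT u w huw, hT₁ u w huw, hsame]
      rw [hE]
      exact ⟨SimpleGraph.Iso.refl⟩
    · obtain ⟨W⟩ := hconn.preconnected a x₀
      obtain ⟨g, hg, -, hbd⟩ := exists_gauge (G := G) Set.univ W hxa h₀ (fun z _ => Set.mem_univ z)
      refine ⟨gaugeIso hg fun u w huw => ?_⟩
      rw [hT₁ u w huw, hT u w huw]
      exact gauge_move_aux (hbd u w huw) fun ⟨h1, h2⟩ => hsame (h1.symm.trans h2)
  · -- at least two twisted edges: cancel two of them and recurse
    push Not at hone
    obtain ⟨e₂, he₂, hne⟩ := hone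
    obtain ⟨b, y, hby, rfl⟩ := hFadj e₂ he₂
    obtain ⟨W⟩ := hconn.preconnected a b
    obtain ⟨g, hg, -, hbd⟩ := exists_gauge (G := G) Set.univ W hxa hby (fun z _ => Set.mem_univ z)
    let T' : Set (Sym2 (Fin v)) := {e | e ∈ T ∧ ¬ e = s(x, a) ∧ ¬ e = s(b, y)}
    have iso₁ : cfiGraph G T ≃g cfiGraph G T' := gaugeIso hg fun u w huw => by
      show s(u, w) ∈ T ∧ ¬ s(u, w) = s(x, a) ∧ ¬ s(u, w) = s(b, y) ↔ _
      exact gauge_cancel_aux (hbd u w huw) (fun ⟨h1, h2⟩ => hne (h2.symm.trans h1))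
        (fun h => (hmemF u w huw).1 (h ▸ he₁)) (fun h => (hmemF u w huw).1 (h ▸ he₂))
    have hF' : G.edgeFinset.filter (· ∈ T') = (F.erase s(x, a)).erase s(b, y) := by
      ext e
      simp only [hF, Finset.mem_filter, Finset.mem_erase, Set.mem_setOf_eq, T']
      tauto
    have hcard : (G.edgeFinset.filter (· ∈ T')).card < n := by
      rw [hF', Finset.card_erase_of_mem (Finset.mem_erase.2 ⟨hne, he₂⟩), Finset.card_erase_of_mem he₁, hn.symm]
      have : 0 < F.card := Finset.card_pos.2 ⟨_, he₁⟩
      omega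
    obtain h | h := ih _ hcard T' rfl
    · obtain ⟨iso'⟩ := h
      exact Or.inl ⟨iso'.comp iso₁⟩
    · obtain ⟨iso'⟩ := h
      exact Or.inr ⟨iso'.comp iso₁⟩

/-! ### The partition function is an isomorphism invariant -/

omit [DecidableRel G.Adj] in
/-- A finite vertex set is independent iff no two of its members are adjacent (any vertex type). -/
theorem isIndepSet_coe_iff' {V : Type*} (H : SimpleGraph V) (I : Finset V) :
    H.IsIndepSet (↑I : Set V) ↔ ∀ a ∈ I, ∀ b ∈ I, ¬ H.Adj a b := by
  constructor
  · intro h a ha b hb hab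
    exact h (Finset.mem_coe.2 ha) (Finset.mem_coe.2 hb) (H.ne_of_adj hab) hab
  · intro h a ha b hb _
    exact h a (Finset.mem_coe.1 ha) b (Finset.mem_coe.1 hb)

omit [DecidableRel G.Adj] in
/-- **The partition function is an isomorphism invariant** (for any decidability instances). -/
theorem independencePolynomial_eq_of_iso {V W : Type*} [Fintype V] [DecidableEq V] [Fintype W]
    [DecidableEq W] {H₁ : SimpleGraph V} {H₂ : SimpleGraph W} [DecidableRel H₁.Adj] [DecidableRel H₂.Adj]
    (e : H₁ ≃g H₂) (z : ℝ) : independencePolynomial H₁ z = independencePolynomial H₂ z := by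
  unfold independencePolynomial
  refine Fintype.sum_equiv (Equiv.finsetCongr e.toEquiv) _ _ fun I => ?_
  rw [Equiv.finsetCongr_apply, Finset.card_map]
  refine if_congr ?_ rfl rfl
  rw [isIndepSet_coe_iff', isIndepSet_coe_iff']
  simp only [Finset.forall_mem_map, Equiv.coe_toEmbedding]
  exact forall₂_congr fun a _ => forall₂_congr fun b _ => by
    rw [show e.toEquiv a = e a from rfl, show e.toEquiv b = e b from rfl, e.map_adj_iff]

/-! ### Conclusion: the even and the odd CFI graph have different partition functions -/

omit [DecidableRel G.Adj] in
/-- The two signs cancel. -/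
theorem sum_sgn : ∑ b, sgn b = 0 := by
  rw [Fintype.sum_bool]; simp [sgn]

/-- **`Z(CFI(G, ∅), λ) ≠ Z(CFI(G, {e}), λ)`** for every connected base graph `G`, every edge `e` and
every `λ > 0`. -/
theorem independencePolynomial_cfi_ne (hconn : G.Connected) {x₀ y₀ : Fin v} (h₀ : G.Adj x₀ y₀)
    (T₁ : Set (Sym2 (Fin v))) [DecidablePred (· ∈ T₁)]
    (hT₁ : ∀ u w, G.Adj u w → (s(u, w) ∈ T₁ ↔ s(u, w) = s(x₀, y₀))) {lam : ℝ} (hlam : 0 < lam) :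
    independencePolynomial (cfiEven G) lam ≠ independencePolynomial (cfiGraph G T₁) lam := by
  intro heq
  haveI : Nontrivial (Fin v) := ⟨⟨x₀, y₀, h₀.ne⟩⟩
  have hdeg : ∀ u : Fin v, (G.neighborFinset u).Nonempty := fun u => by
    rw [← Finset.card_pos, SimpleGraph.card_neighborFinset_eq_degree]
    exact hconn.preconnected.degree_pos_of_nontrivial u
  have hall : ∀ τ : ODart G → Bool,
      independencePolynomial (cfiGraph G (twistSet τ)) lam = independencePolynomial (cfiEven G) lam := by
    intro τ
    obtain h | h := cfiGraph_iso_dichotomy hconn h₀ T₁ hT₁ _ (twistSet τ) rfl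
    · obtain ⟨iso⟩ := h
      exact independencePolynomial_eq_of_iso iso lam
    · obtain ⟨iso⟩ := h
      rw [independencePolynomial_eq_of_iso iso lam, heq]
  have h := signedSum_ne_zero hdeg hlam
  simp only [hall] at h
  rw [← Finset.sum_mul, ← Fintype.prod_sum fun (_ : ODart G) (b : Bool) => sgn b] at h
  apply h
  rw [Finset.prod_eq_zero (Finset.mem_univ (orient ⟨(x₀, y₀), h₀⟩)) sum_sgn, zero_mul]

end

end Summit.PneNP.PneNP.PhaseTwins.ConstantFactorTwins
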